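import Mathlib
import Literature.NumberTheory.Irrationality.Lai2025TwoAdic.LinearFormsT
import Literature.NumberTheory.Irrationality.LaiSprangZudilin2026.TwoAdicEstimate
import HarnessLib

/-!
# Lai 2025 (IJNT, `2`-adic zeta values), §6 at `s = 0`: the exact `2`-adic valuation
# `v₂(T_n) = 12n − 3m + 4` along `n = 2^m − 1`, hence `T_n ≠ 0` (Lemma 6.3) — PROVED

Topic `Literature/NumberTheory/Irrationality/Lai2025TwoAdic`.  Source: L. Lai, *On the irrationality of certain
`2`-adic zeta values*, Int. J. Number Theory (2025) = arXiv:2304.00816 [Lai2025TwoAdicZeta], §2.2 (Definition 2.3,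
Lemmas 2.4–2.5) and §6 (Lemmas 6.1–6.3) (held text `paper:arxiv-2304.00816`, chunks p0005–p0006, p0011–p0012, read
on the page).  PROOF FILE (definitions with bodies + theorems; no named fact, net debt 0); file 3 of the tree's
discharge of [Calegari2005, Thm 3.3] (`ζ₂(3) ∉ ℚ`) along the printed alternative proof [Lai2025TwoAdicZeta, Thm 1.3
at `s = 0`].  Companion of `LinearFormsT.lean` (`DB n` = `B_n(t+¼)`, `T n = ∫_{ℤ₂} B_n(t+¼) dt`).

## Source, as printed (`s = 0`)

* **Definition 2.3 / Lemma 2.4.** «`Δ_m(f) := inf_{k ≥ p^m} v_p((f(k) − f(k_−))/(k − k_−))` … (2.3)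
  `∫_{ℤ_p} f(t)dt ≡ p^{−m}Σ_{k=0}^{p^m−1} f(k) (mod p^{Δ_m(f)−1}ℤ_p)`» (digit peeling:
  `p^{−M}Σ_{k<p^M} f(k) = p^{−m}Σ_{k<p^m} f(k) + Σ_{l=m}^{M−1}Σ_{k=p^l}^{p^{l+1}−1} (f(k) − f(k_−))/p^{l+1}`).
* **Lemma 2.5 (3).** «for `m > ⌊log n/log p⌋` we have `Δ_m(f^p) ≥ −⌊log n/log p⌋ + 1`» (`f = binom(t+j,n)`: `f(k) ≡ f(k_−)`
  so `Σ_i f(k)^i f(k_−)^{p−1−i} ≡ p f(k)^{p−1} ≡ 0 (mod p)`).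
* **Lemma 6.3** (`s = 0`, `n = 2^m − 1`, `m ≥ 2`): «`v₂(d_n^{2s+3}T_n) = (6s+12)n + s + v₂((s+2)!)`.  In particular
  `d_n^{2s+3}T_n ≠ 0`.»  *Proof.* «`v₂(d_n) = m−1` … `B_n(t+¼) = 2^{(5s+10)n+2s+4}·f(t)`, `f(t) = (t+1)^{s+2}⋯(t+n)^{s+2}g(t)`,
  `g(t) = ∏_{k=0}^{n}(4t+4k+1)^{−(s+2)}` … it suffices to show `v₂(∫_{ℤ₂}f^{(s)}(t)dt) = (s+2)n − (2s+3)m + s + v₂((s+2)!) − 1`»;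
  at `s = 0` the Leibniz sum has the single term `f = n!²·binom(t+n,n)²·g`, and the proof of (eqn_dominating_term)
  applies verbatim: «`Δ_m(g(t)binom(t+2^m−1,2^m−1)²⋯) ≥ −m+2` … Note that `binom(k+2^m−1,2^m−1)` is even for `1 ≤ k ≤ 2^m−1`
  by either Kummer's or Lucas' theorem and `g(0) ≡ 1 (mod 2ℤ₂)`.  We obtain
  `∫_{ℤ₂} g(t)binom(t+2^m−1,2^m−1)² dt ∈ 2^{−m} + 2^{−m+1}ℤ₂`», i.e. valuation exactly `−m`.

## What is formalised (all PROVED; the `Δ_m` calculus in the tree's Lipschitz form of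
## `PAdicZetaValues/VolkenbornDeltaOperator.lean`)

* `LipNatMod p m M g` — the clause `Δ_m` in Lipschitz form: `‖g(k + p^m h) − g(k)‖_p ≤ M‖p^m h‖_p` (differences along
  multiples of `p^m` only); `lipNatMod_of_lipNat`, `LipNatMod.mul` (Lemma 2.5 (2) for `Δ_m`), and **Lemma 2.5 (3) for
  `p = 2`**: `LipNatMod.sq_two` — if `‖f(k+h) − f(k)‖₂ ≤ M‖h‖₂` with `M·2^{−m} ≤ ½` and `f` is `ℤ₂`-valued then
  `‖f(k+2^m h)² − f(k)²‖₂ ≤ (M/2)‖2^m h‖₂` (the square gains a factor `2`).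
* **Lemma 2.4 (2.3)**: `norm_sub_volkenbornSum_le_of_lipNatMod` — if `LipNatMod p m M f|_ℕ` and the Riemann sums of `f`
  tend to `I`, then `‖I − p^{−m}Σ_{k<p^m}f(k)‖_p ≤ p·M` (digit peeling above level `m`).
* `Fq n j = binom(j+n,n)²·g(j)`, `g(j) = ∏_{i≤n}(4j+4i+1)^{−2}` and `cstB n = 2^{10n+4}(n!)²`, with `DB_natCast_eq`:
  `B_n(j+¼) = cstB n · Fq n j` at every natural `j` (from `RationalFunctionB.B_natCast_add_quarter`).
* Along `n = 2^m − 1` (`m ≥ 1`): `two_dvd_choose_add_mersenne` (Kummer, via Mathlib's `padicValNat_choose'`: the carry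
  at the `m`-th digit), `norm_sum_Fq_eq_one` (`‖Σ_{k<2^m} Fq n k‖₂ = 1`: the `k = 0` term is a unit, the others lie in
  `4ℤ₂`), `lipNatMod_Fq` (`Δ_m ≥ −m+2`), and **Lemma 6.3 at `s = 0`**: `norm_T_mersenne`
  (`‖T_n‖₂ = 2^{−(10n+4)}·‖n!‖₂²·2^m`, i.e. `v₂(T_n) = 10n + 4 + 2v₂(n!) − m = 12n − 3m + 4` as `v₂(n!) = n − m`),
  `T_mersenne_ne_zero` (**`T_n ≠ 0`**) and the bound `norm_T_mersenne_le` (`‖T_n‖₂ ≤ 2^{3m − 12n − 4}`, through the tree's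
  Legendre bound `LaiSprangZudilin2026.norm_factorial_le`).

Cell zeta5-irr / pub-zeta5 (HONEST FRAMING: systematic search; no irrationality claim unless kernel-certified):
`2`-adic valuation of linear forms in `1, ζ₂(3,¼)`; nothing here bears on `ζ(5) ∈ ℝ`.
-/

noncomputable section

open Finset Filter Topology
open Literature.NumberTheory.LocalFields
open Literature.NumberTheory.Irrationality.PAdicZetaValues
open Literature.NumberTheory.Irrationality.LaiSprangZudilin2026 (norm_natCast_eq_two_zpow norm_factorial_eq
  norm_two_pow norm_factorial_le)
open scoped Nat

namespace Literature.NumberTheory.Irrationality.Lai2025TwoAdic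

/-! ## §1. The clause `Δ_m` in Lipschitz form and Lemma 2.5 (2), (3) -/

section General

variable {p : ℕ} [hp : Fact p.Prime]

/-- **The clause `Δ_m` of Definition 2.3, Lipschitz form** (values at the naturals): `‖g(k + p^m h) − g(k)‖_p ≤ M‖p^m h‖_p`
for all `k, h ∈ ℕ` — only differences along multiples of `p^m` are constrained (for `k ≥ p^m`, `k − k_−` is such a
multiple), `Δ_m(g) ≥ −log_p M`. [cite: Lai2025TwoAdicZeta, Definition 2.3 (Δ_m)] -/
def LipNatMod (p : ℕ) [Fact p.Prime] (m : ℕ) (M : ℝ) (g : ℕ → ℚ_[p]) : Prop :=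
  ∀ k h : ℕ, ‖g (k + p ^ m * h) - g k‖ ≤ M * ‖((p ^ m * h : ℕ) : ℚ_[p])‖

/-- `Δ_m(f) ≥ Δ(f)`: a Lipschitz function is Lipschitz along multiples of `p^m`. [cite: Lai2025TwoAdicZeta, Definition 2.3 ("Δ(f) ≤ Δ₀(f) ≤ Δ₁(f) ≤ ⋯")] -/
theorem lipNatMod_of_lipNat {M : ℝ} {f : ℕ → ℚ_[p]} (hf : LipNat p M f) (m : ℕ) : LipNatMod p m M f :=
  fun k h => hf k (p ^ m * h)

/-- **Lemma 2.5 (2) for `Δ_m`:** for `ℤ_p`-valued `f, g`, `Δ_m(fg) ≥ min{Δ_m(f), Δ_m(g)}` (Lipschitz form).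
[cite: Lai2025TwoAdicZeta, Lemma 2.5 (2)] -/
theorem LipNatMod.mul {m : ℕ} {M M' : ℝ} {f g : ℕ → ℚ_[p]} (hf : LipNatMod p m M f) (hg : LipNatMod p m M' g)
    (hfb : BddNat p f) (hgb : BddNat p g) : LipNatMod p m (max M M') (fun k => f k * g k) := by
  intro k h
  have e : f (k + p ^ m * h) * g (k + p ^ m * h) - f k * g k =
      f (k + p ^ m * h) * (g (k + p ^ m * h) - g k) + g k * (f (k + p ^ m * h) - f k) := by ring
  rw [e]
  refine (IsUltrametricDist.norm_add_le_max _ _).trans (max_le ?_ ?_)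
  · rw [norm_mul]
    calc ‖f (k + p ^ m * h)‖ * ‖g (k + p ^ m * h) - g k‖ ≤ 1 * (M' * ‖((p ^ m * h : ℕ) : ℚ_[p])‖) :=
          mul_le_mul (hfb _) (hg k h) (norm_nonneg _) zero_le_one
      _ ≤ max M M' * ‖((p ^ m * h : ℕ) : ℚ_[p])‖ := by
          rw [one_mul]; exact mul_le_mul_of_nonneg_right (le_max_right _ _) (norm_nonneg _)
  · rw [norm_mul]
    calc ‖g k‖ * ‖f (k + p ^ m * h) - f k‖ ≤ 1 * (M * ‖((p ^ m * h : ℕ) : ℚ_[p])‖) :=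
          mul_le_mul (hgb _) (hf k h) (norm_nonneg _) zero_le_one
      _ ≤ max M M' * ‖((p ^ m * h : ℕ) : ℚ_[p])‖ := by
          rw [one_mul]; exact mul_le_mul_of_nonneg_right (le_max_left _ _) (norm_nonneg _)

/-- `‖p^m h‖_p ≤ p^{−m}`. [folklore] -/
private theorem norm_natCast_pow_mul_le (m h : ℕ) : ‖((p ^ m * h : ℕ) : ℚ_[p])‖ ≤ (p : ℝ) ^ (-(m : ℤ)) := by
  push_cast
  rw [norm_mul, norm_pow, Padic.norm_p, zpow_neg, zpow_natCast, inv_pow]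
  have hh : ‖(h : ℚ_[p])‖ ≤ 1 := by
    have := Padic.norm_int_le_one (p := p) (h : ℤ)
    rwa [Int.cast_natCast] at this
  exact mul_le_of_le_one_right (by positivity) hh

/-! ### Lemma 2.4, (2.3): digit peeling above level `m` -/

/-- The one-step estimate above level `m`: if `LipNatMod p m M f|_ℕ` then `‖S_{N+1}(f) − S_N(f)‖_p ≤ p·M` for every
`N ≥ m` (`S_N` the Riemann sums; `p^N c = p^m·(p^{N−m}c)`). [cite: Lai2025TwoAdicZeta, Lemma 2.4 (proof: the terms (f(k) − f(k_−))/p^{l+1}, l ≥ m)] -/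
theorem norm_volkenbornSum_succ_sub_le_of_lipNatMod {m : ℕ} {M : ℝ} {f : ℤ_[p] → ℚ_[p]} (hM : 0 ≤ M)
    (hf : LipNatMod p m M (fun k : ℕ => f k)) {N : ℕ} (hN : m ≤ N) :
    ‖volkenbornSum p f (N + 1) - volkenbornSum p f N‖ ≤ p * M := by
  have hp0 : (0 : ℝ) < p := by exact_mod_cast hp.out.pos
  rw [volkenbornSum_succ_sub, norm_smul, norm_inv, norm_pow, Padic.norm_p, inv_pow, inv_inv]
  have hsum : ‖∑ c ∈ range p, ∑ i ∈ range (p ^ N),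
      (f ((p ^ N * c + i : ℕ) : ℤ_[p]) - f (i : ℤ_[p]))‖ ≤ M * (p : ℝ) ^ (-(N : ℤ)) := by
    refine IsUltrametricDist.norm_sum_le_of_forall_le_of_nonneg (by positivity) fun c _ => ?_
    refine IsUltrametricDist.norm_sum_le_of_forall_le_of_nonneg (by positivity) fun i _ => ?_
    have hsplit : p ^ N * c + i = i + p ^ m * (p ^ (N - m) * c) := by
      rw [← mul_assoc, ← pow_add, Nat.add_sub_cancel' hN, Nat.add_comm]
    have h := hf i (p ^ (N - m) * c)
    rw [hsplit]
    refine h.trans (mul_le_mul_of_nonneg_left ?_ hM)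
    have e : p ^ m * (p ^ (N - m) * c) = p ^ N * c := by
      rw [← mul_assoc, ← pow_add, Nat.add_sub_cancel' hN]
    rw [e]
    exact norm_natCast_pow_mul_le N c
  refine (mul_le_mul_of_nonneg_left hsum (by positivity)).trans (le_of_eq ?_)
  rw [zpow_neg, zpow_natCast, pow_succ]
  field_simp

/-- All Riemann sums beyond level `m` stay within `p·M` of `S_m`. [cite: Lai2025TwoAdicZeta, Lemma 2.4 (2.3)] -/
theorem norm_volkenbornSum_sub_le_of_lipNatMod {m : ℕ} {M : ℝ} {f : ℤ_[p] → ℚ_[p]} (hM : 0 ≤ M)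
    (hf : LipNatMod p m M (fun k : ℕ => f k)) {N : ℕ} (hN : m ≤ N) :
    ‖volkenbornSum p f N - volkenbornSum p f m‖ ≤ p * M := by
  induction N, hN using Nat.le_induction with
  | base => simp; positivity
  | succ N hN ih =>
    have e : volkenbornSum p f (N + 1) - volkenbornSum p f m =
        (volkenbornSum p f (N + 1) - volkenbornSum p f N) + (volkenbornSum p f N - volkenbornSum p f m) := by abel
    rw [e]
    exact (IsUltrametricDist.norm_add_le_max _ _).trans
      (max_le (norm_volkenbornSum_succ_sub_le_of_lipNatMod hM hf hN) ih)

/-- **Lemma 2.4, (2.3)** (Lipschitz form): `∫_{ℤ_p} f ≡ p^{−m}Σ_{k<p^m} f(k) (mod p^{Δ_m(f)−1})` — if `LipNatMod p m M f|_ℕ` and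
the Riemann sums tend to `I`, then `‖I − S_m(f)‖_p ≤ p·M`. [cite: Lai2025TwoAdicZeta, Lemma 2.4 (2.3)] -/
theorem norm_sub_volkenbornSum_le_of_lipNatMod {m : ℕ} {M : ℝ} {f : ℤ_[p] → ℚ_[p]} (hM : 0 ≤ M)
    (hf : LipNatMod p m M (fun k : ℕ => f k)) {I : ℚ_[p]} (hI : Tendsto (volkenbornSum p f) atTop (𝓝 I)) :
    ‖I - volkenbornSum p f m‖ ≤ p * M := by
  have h := (hI.sub_const (volkenbornSum p f m)).norm
  exact le_of_tendsto h (eventually_atTop.2 ⟨m, fun N hN => norm_volkenbornSum_sub_le_of_lipNatMod hM hf hN⟩)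

end General

/-! ### Lemma 2.5 (3) at `p = 2`: squares gain a factor `2` along multiples of `2^m` -/

/-- `‖2‖₂ = ½`. [folklore] -/
private theorem norm_two : ‖(2 : ℚ_[2])‖ = 2⁻¹ := by simpa using Padic.norm_p (p := 2)

/-- **Lemma 2.5 (3), `p = 2`** (Lipschitz form): if `‖f(k+h) − f(k)‖₂ ≤ M‖h‖₂` on `ℕ`, `f` is `ℤ₂`-valued and
`M·2^{−m} ≤ ½` (i.e. `f(k + 2^m h) ≡ f(k) (mod 2)`), then `‖f(k+2^m h)² − f(k)²‖₂ ≤ (M/2)·‖2^m h‖₂`: for `m > ⌊log₂ n⌋`,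
`Δ_m(f²) ≥ Δ(f) + 1` («`f(k) ≡ f(k_−)` and `Σ_i f(k)^i f(k_−)^{p−1−i} ≡ p f(k)^{p−1} ≡ 0 (mod p)`»).
[cite: Lai2025TwoAdicZeta, Lemma 2.5 (3) (the bound Δ_m(f^p) ≥ −⌊log n/log p⌋ + 1)] -/
theorem LipNatMod.sq_two {m : ℕ} {M : ℝ} {f : ℕ → ℚ_[2]} (hf : LipNat 2 M f) (hfb : BddNat 2 f) (hM : 0 ≤ M)
    (hMm : M * (2 : ℝ) ^ (-(m : ℤ)) ≤ 2⁻¹) : LipNatMod 2 m (M / 2) (fun k => f k ^ 2) := by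
  intro k h
  set H : ℕ := 2 ^ m * h with hH
  set δ : ℚ_[2] := f (k + H) - f k with hδ
  have hδle : ‖δ‖ ≤ M * ‖(H : ℚ_[2])‖ := hf k H
  have hH' : ‖(H : ℚ_[2])‖ ≤ (2 : ℝ) ^ (-(m : ℤ)) := by
    have := norm_natCast_pow_mul_le (p := 2) m h
    simpa [hH] using this
  have hδhalf : ‖δ‖ ≤ 2⁻¹ := hδle.trans ((mul_le_mul_of_nonneg_left hH' hM).trans hMm)
  -- `f(k+H)² − f(k)² = δ·(2f(k) + δ)` with `‖2f(k) + δ‖ ≤ ½`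
  have e : f (k + H) ^ 2 - f k ^ 2 = δ * (2 * f k + δ) := by rw [hδ]; ring
  have h2 : ‖2 * f k + δ‖ ≤ 2⁻¹ := by
    refine (IsUltrametricDist.norm_add_le_max _ _).trans (max_le ?_ hδhalf)
    rw [norm_mul, norm_two]
    exact mul_le_of_le_one_right (by norm_num) (hfb k)
  show ‖f (k + H) ^ 2 - f k ^ 2‖ ≤ M / 2 * ‖(H : ℚ_[2])‖
  rw [e, norm_mul]
  calc ‖δ‖ * ‖2 * f k + δ‖ ≤ (M * ‖(H : ℚ_[2])‖) * 2⁻¹ :=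
        mul_le_mul hδle h2 (norm_nonneg _) (by positivity)
    _ = M / 2 * ‖(H : ℚ_[2])‖ := by ring

/-! ## §2. The integrand at the naturals: `B_n(j+¼) = 2^{10n+4}(n!)² · binom(j+n,n)² · g(j)²` -/

/-- `g(j) := ∏_{i ≤ n} (4j + 4i + 1)⁻¹` (so `g(t)` of §6 at `s = 0` is `g(j)²`). [cite: Lai2025TwoAdicZeta, Lemma 6.3 (proof: g(t) = ∏_{k=0}^{n}(4t+4k+1)^{−(s+2)})] -/
def gq (n j : ℕ) : ℚ_[2] := ∏ i ∈ range (n + 1), ((4 : ℚ_[2]) * j + ((4 * i + 1 : ℕ) : ℚ_[2]))⁻¹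

/-- `binom(j+n, n)` in `ℚ₂`. [cite: Lai2025TwoAdicZeta, Lemma 6.3 (proof: (t+1)⋯(t+n) = n!·binom(t+n,n))] -/
def Cq (n j : ℕ) : ℚ_[2] := (((j + n).choose n : ℕ) : ℚ_[2])

/-- `F(j) := binom(j+n,n)²·g(j)²` — the function `f/n!²` of §6 at `s = 0`, at the naturals. [cite: Lai2025TwoAdicZeta, Lemma 6.3 (proof: f_{(0,…,0)})] -/
def Fq (n j : ℕ) : ℚ_[2] := Cq n j ^ 2 * gq n j ^ 2

/-- The constant `2^{10n+4}·(n!)²` (`= 2^{(5s+10)n+2s+4}·n!^{s+2}` at `s = 0`). [cite: Lai2025TwoAdicZeta, Lemma 6.3 (proof: B_n(t+¼) = 2^{(5s+10)n+2s+4}f(t))] -/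
def cstB (n : ℕ) : ℚ_[2] := (2 : ℚ_[2]) ^ (10 * n + 4) * (((n ! : ℕ) : ℚ_[2])) ^ 2

/-- `cstB n ≠ 0`. [cite: Lai2025TwoAdicZeta, Lemma 6.3 (proof)] -/
theorem cstB_ne_zero (n : ℕ) : cstB n ≠ 0 := by
  unfold cstB
  exact mul_ne_zero (pow_ne_zero _ two_ne_zero) (pow_ne_zero _ (by exact_mod_cast Nat.factorial_ne_zero n))

/-- **`B_n(j+¼) = 2^{10n+4}(n!)²·binom(j+n,n)²·g(j)²`** at every natural `j` — the value of the `2`-adic integrand `DB n`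
(tree form of `RationalFunctionB.B_natCast_add_quarter`). [cite: Lai2025TwoAdicZeta, Lemma 6.3 (proof: the displays for B_n(t+¼), f, g)] -/
theorem DB_natCast_eq (n j : ℕ) : DB n (j : ℤ_[2]) = cstB n * Fq n j := by
  rw [DB_natCast, DBq_natCast_eq_B, B_natCast_add_quarter]
  have hP : ∏ i ∈ range (n + 1), ((4 : ℚ_[2]) * j + ((4 * i + 1 : ℕ) : ℚ_[2])) ≠ 0 := by
    refine prod_ne_zero_iff.2 fun i _ => ?_
    have h1 : ‖((4 : ℚ_[2]) * j + ((4 * i + 1 : ℕ) : ℚ_[2]))‖ = 1 := by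
      have e : ((4 : ℚ_[2]) * j + ((4 * i + 1 : ℕ) : ℚ_[2])) = (((4 * j + 4 * i + 1 : ℕ)) : ℚ_[2]) := by
        push_cast; ring
      rw [e]
      exact norm_natCast_of_not_dvd (p := 2) (by omega)
    intro h0; rw [h0, norm_zero] at h1; exact zero_ne_one h1
  rw [Fq, Cq, gq, cstB, prod_inv_distrib]
  push_cast
  have e2 : ∏ i ∈ range (n + 1), (4 * (j : ℚ_[2]) + 4 * (i : ℚ_[2]) + 1) =
      ∏ i ∈ range (n + 1), ((4 : ℚ_[2]) * j + (4 * (i : ℚ_[2]) + 1)) := prod_congr rfl fun i _ => by ring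
  rw [e2]
  have hP' : ∏ i ∈ range (n + 1), ((4 : ℚ_[2]) * j + (4 * (i : ℚ_[2]) + 1)) ≠ 0 := by
    convert hP using 2
    push_cast; rfl
  field_simp

/-! ### The Lipschitz data of `g`, `binom(·+n,n)` and `F` -/

/-- `‖4‖₂ = ¼`. [folklore] -/
private theorem norm_four : ‖(4 : ℚ_[2])‖ = 4⁻¹ := by
  have h := norm_inv_four
  rw [norm_inv] at h
  rw [← inv_inv ‖(4 : ℚ_[2])‖, h]

/-- Each factor `(4j + 4i + 1)^{−1}` of `g` is `ℤ₂`-valued with Lipschitz constant `‖4‖₂ = ¼` (Lemma 2.5 (1):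
`Δ ≥ 0` for a convergent power series with coefficients `c_k ∈ 2^kℤ₂`). [cite: Lai2025TwoAdicZeta, Lemma 6.3 (proof: "g(t) = Σ c_k t^k, c_k ∈ 2^kℤ₂ … Δ_m(g^{(j)}/j!) ≥ 0")] -/
theorem lipNat_gq_factor (i : ℕ) :
    LipNat 2 ‖(4 : ℚ_[2])‖ (fun j : ℕ => ((4 : ℚ_[2]) * j + ((4 * i + 1 : ℕ) : ℚ_[2]))⁻¹) ∧
      BddNat 2 (fun j : ℕ => ((4 : ℚ_[2]) * j + ((4 * i + 1 : ℕ) : ℚ_[2]))⁻¹) := by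
  have ha : ‖(4 : ℚ_[2])‖ < 1 := by rw [norm_four]; norm_num
  have hb : ‖((4 * i + 1 : ℕ) : ℚ_[2])‖ = 1 := norm_natCast_of_not_dvd (p := 2) (by omega)
  exact ⟨lipNat_inv_linear ha hb, bddNat_inv_linear ha hb⟩

/-- `g` is `ℤ₂`-valued with Lipschitz constant `¼` (`Δ(g) ≥ 0`), and so is `g²`. [cite: Lai2025TwoAdicZeta, Lemma 6.3 (proof: Δ_m(g) ≥ Δ(g) ≥ 0)] -/
theorem lipNat_gq_sq (n : ℕ) : LipNat 2 ‖(4 : ℚ_[2])‖ (fun j => gq n j ^ 2) ∧ BddNat 2 (fun j => gq n j ^ 2) := by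
  have h1 : LipNat 2 ‖(4 : ℚ_[2])‖ (gq n) :=
    LipNat.finset_prod (range (n + 1)) (norm_nonneg _) (fun i _ => (lipNat_gq_factor i).1) fun i _ => (lipNat_gq_factor i).2
  have h2 : BddNat 2 (gq n) := BddNat.finset_prod (range (n + 1)) fun i _ => (lipNat_gq_factor i).2
  exact ⟨h1.pow h2 (norm_nonneg _) 2, h2.pow 2⟩

/-- **Lemma 2.5 (3) for `binom(t+n,n)²` at `p = 2`:** if `n < 2^m` then `Δ_m(binom(t+n,n)²) ≥ −⌊log₂ n⌋ + 1`, i.e.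
`‖binom(k+2^m h+n,n)² − binom(k+n,n)²‖₂ ≤ 2^{⌊log₂ n⌋−1}‖2^m h‖₂`. [cite: Lai2025TwoAdicZeta, Lemma 2.5 (3) and Lemma 6.3 (proof: "Δ_m(binom(t+2^m−1,2^m−1)²) ≥ −(m−1)+1")] -/
theorem lipNatMod_Cq_sq {n m : ℕ} (hm : 1 ≤ m) (hnm : n < 2 ^ m) :
    LipNatMod 2 m ((2 : ℝ) ^ Nat.log 2 n / 2) (fun j => Cq n j ^ 2) := by
  have hC : LipNat 2 ((2 : ℝ) ^ Nat.log 2 n) (Cq n) := lipNat_choose (p := 2) n n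
  have hCb : BddNat 2 (Cq n) := BddNat.natCast (p := 2) fun j => (j + n).choose n
  refine LipNatMod.sq_two hC hCb (by positivity) ?_
  -- `2^{⌊log₂ n⌋} · 2^{−m} ≤ ½` since `⌊log₂ n⌋ + 1 ≤ m`
  have hlog : Nat.log 2 n + 1 ≤ m := by
    rcases Nat.eq_zero_or_pos n with rfl | hn
    · simpa using hm
    · exact Nat.succ_le_of_lt ((Nat.log_lt_iff_lt_pow (by norm_num) hn.ne').2 hnm)
  rw [← zpow_natCast, ← zpow_add₀ (by norm_num : (2 : ℝ) ≠ 0), show (2 : ℝ)⁻¹ = 2 ^ (-(1 : ℤ)) by norm_num]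
  exact zpow_le_zpow_right₀ (by norm_num) (by omega)

/-- **`Δ_m(F) ≥ −m + 2`** for `n < 2^m` with `⌊log₂ n⌋ = m − 1` (in general: constant `max(2^{⌊log₂n⌋−1}, ¼)`):
`F = binom(·+n,n)²·g²` with Lemma 2.5 (2). [cite: Lai2025TwoAdicZeta, Lemma 6.3 (proof: "Δ_m(g(t)binom(t+2^m−1,2^m−1)²⋯) ≥ −m+2")] -/
theorem lipNatMod_Fq {n m : ℕ} (hm : 1 ≤ m) (hnm : n < 2 ^ m) :
    LipNatMod 2 m (max ((2 : ℝ) ^ Nat.log 2 n / 2) ‖(4 : ℚ_[2])‖) (Fq n) := by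
  have h1 := lipNatMod_Cq_sq hm hnm
  have h2 := lipNat_gq_sq n
  have hCb : BddNat 2 (fun j => Cq n j ^ 2) := (BddNat.natCast (p := 2) fun j => (j + n).choose n).pow 2
  exact h1.mul (lipNatMod_of_lipNat h2.1 m) hCb h2.2

/-! ## §3. Along `n = 2^m − 1`: the Riemann sum at level `m` is a unit times `2^m` -/

/-- **Kummer at the `m`-th binary digit:** for `1 ≤ k < 2^m`, `binom(k + 2^m − 1, 2^m − 1)` is even («by either Kummer's or
Lucas' theorem»: adding `k` and `2^m − 1 = 11⋯1₂` produces a carry out of the lowest `m` digits).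
[cite: Lai2025TwoAdicZeta, Lemma 6.3 (proof: "binom(k+2^m−1, 2^m−1) is even for 1 ≤ k ≤ 2^m−1")] -/
theorem two_dvd_choose_add_mersenne {m k : ℕ} (hm : 1 ≤ m) (hk1 : 1 ≤ k) (hk : k < 2 ^ m) :
    2 ∣ (k + (2 ^ m - 1)).choose (2 ^ m - 1) := by
  haveI := Fact.mk Nat.prime_two
  have hpos : 0 < (k + (2 ^ m - 1)).choose (2 ^ m - 1) := Nat.choose_pos (by omega)
  have h2m : 1 ≤ 2 ^ m := Nat.one_le_two_pow
  -- `v₂(binom(k + n, n)) = #{i : carries}`, and `i = m` is a carry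
  set b := Nat.log 2 (k + (2 ^ m - 1)) + 1 with hb
  have hv := padicValNat_choose' (p := 2) (n := k) (k := 2 ^ m - 1) (b := b) (by omega)
  have hmem : m ∈ (Finset.Ico 1 b).filter (fun i => 2 ^ i ≤ (2 ^ m - 1) % 2 ^ i + k % 2 ^ i) := by
    rw [mem_filter, mem_Ico]
    refine ⟨⟨hm, ?_⟩, ?_⟩
    · -- `m ≤ log₂(k + 2^m − 1)` as `2^m ≤ k + 2^m − 1`
      rw [hb]
      exact Nat.lt_succ_of_le (Nat.le_log_of_pow_le (by norm_num) (by omega))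
    · rw [Nat.mod_eq_of_lt (by omega : 2 ^ m - 1 < 2 ^ m), Nat.mod_eq_of_lt hk]
      omega
  have hcard : 1 ≤ padicValNat 2 ((k + (2 ^ m - 1)).choose (2 ^ m - 1)) := by
    rw [hv]
    exact Finset.card_pos.2 ⟨m, hmem⟩
  exact dvd_of_one_le_padicValNat hcard

/-- `‖binom(k+n,n)‖₂ ≤ ½` for `1 ≤ k < 2^m`, `n = 2^m − 1`. [cite: Lai2025TwoAdicZeta, Lemma 6.3 (proof: evenness of binom(k+2^m−1,2^m−1))] -/
theorem norm_Cq_le_half {m k : ℕ} (hm : 1 ≤ m) (hk1 : 1 ≤ k) (hk : k < 2 ^ m) :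
    ‖Cq (2 ^ m - 1) k‖ ≤ 2⁻¹ := by
  have hpos : (k + (2 ^ m - 1)).choose (2 ^ m - 1) ≠ 0 := (Nat.choose_pos (by omega)).ne'
  have hv : 1 ≤ padicValNat 2 ((k + (2 ^ m - 1)).choose (2 ^ m - 1)) := by
    haveI := Fact.mk Nat.prime_two
    exact (padicValNat_dvd_iff_le hpos).1 (by simpa using two_dvd_choose_add_mersenne hm hk1 hk)
  rw [Cq, norm_natCast_eq_two_zpow hpos, show (2 : ℝ)⁻¹ = 2 ^ (-(1 : ℤ)) by norm_num]
  exact zpow_le_zpow_right₀ (by norm_num) (by omega)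

/-- `‖g(j)‖₂ = 1` (a product of units `(4j+4i+1)^{−1}`). [cite: Lai2025TwoAdicZeta, Lemma 6.3 (proof: "g(0) ≡ 1 (mod 2ℤ₂)")] -/
theorem norm_gq (n j : ℕ) : ‖gq n j‖ = 1 := by
  rw [gq, norm_prod]
  refine prod_eq_one fun i _ => ?_
  have ha : ‖(4 : ℚ_[2])‖ < 1 := by rw [norm_four]; norm_num
  rw [norm_inv, norm_linear_eq_one ha (norm_natCast_of_not_dvd (p := 2) (by omega)), inv_one]

/-- `‖F(0)‖₂ = 1` (`binom(n,n) = 1`, `g(0)` a unit). [cite: Lai2025TwoAdicZeta, Lemma 6.3 (proof: "g(0) ≡ 1 (mod 2ℤ₂)")] -/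
theorem norm_Fq_zero (n : ℕ) : ‖Fq n 0‖ = 1 := by
  rw [Fq, Cq, norm_mul, norm_pow, norm_pow, norm_gq, zero_add, Nat.choose_self, Nat.cast_one, norm_one, one_pow,
    mul_one]

/-- `‖F(k)‖₂ ≤ ¼` for `1 ≤ k < 2^m`, `n = 2^m − 1`. [cite: Lai2025TwoAdicZeta, Lemma 6.3 (proof: the terms k ≥ 1 of the Riemann sum)] -/
theorem norm_Fq_le_quarter {m k : ℕ} (hm : 1 ≤ m) (hk1 : 1 ≤ k) (hk : k < 2 ^ m) :
    ‖Fq (2 ^ m - 1) k‖ ≤ 4⁻¹ := by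
  rw [Fq, norm_mul, norm_pow, norm_pow, norm_gq, one_pow, mul_one]
  calc ‖Cq (2 ^ m - 1) k‖ ^ 2 ≤ (2⁻¹ : ℝ) ^ 2 := pow_le_pow_left₀ (norm_nonneg _) (norm_Cq_le_half hm hk1 hk) 2
    _ = 4⁻¹ := by norm_num

/-- **`‖Σ_{k<2^m} F(k)‖₂ = 1`** (`n = 2^m − 1`): the `k = 0` term is a unit and the others have norm `≤ ¼`
(«`binom(k+2^m−1,2^m−1)` is even for `1 ≤ k ≤ 2^m − 1` … and `g(0) ≡ 1 (mod 2ℤ₂)`»). [cite: Lai2025TwoAdicZeta, Lemma 6.3 (proof of (eqn_5_1))] -/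
theorem norm_sum_Fq_eq_one {m : ℕ} (hm : 1 ≤ m) : ‖∑ k ∈ range (2 ^ m), Fq (2 ^ m - 1) k‖ = 1 := by
  have h2m : 1 ≤ 2 ^ m := Nat.one_le_two_pow
  rw [← Finset.sum_range_add_sum_Ico _ h2m, Finset.sum_range_one]
  have hrest : ‖∑ k ∈ Ico 1 (2 ^ m), Fq (2 ^ m - 1) k‖ ≤ 4⁻¹ := by
    refine IsUltrametricDist.norm_sum_le_of_forall_le_of_nonneg (by norm_num) fun k hk => ?_
    have hk' := mem_Ico.1 hk
    exact norm_Fq_le_quarter hm hk'.1 hk'.2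
  have hne : ‖Fq (2 ^ m - 1) 0‖ ≠ ‖∑ k ∈ Ico 1 (2 ^ m), Fq (2 ^ m - 1) k‖ := by
    rw [norm_Fq_zero]; exact ne_of_gt (hrest.trans_lt (by norm_num))
  rw [Padic.add_eq_max_of_ne hne, norm_Fq_zero, max_eq_left (hrest.trans (by norm_num))]

/-! ## §4. Lemma 6.3 at `s = 0`: `‖T_n‖₂ = 2^{−(10n+4)}·‖n!‖₂²·2^m` for `n = 2^m − 1`, so `T_n ≠ 0` -/

/-- The normalised integrand `F(t) := B_n(t+¼)/(2^{10n+4}(n!)²)` on `ℤ₂` (its values at the naturals are `Fq n`).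
[cite: Lai2025TwoAdicZeta, Lemma 6.3 (proof: f = B_n(t+¼)/2^{(5s+10)n+2s+4})] -/
def Fz (n : ℕ) (t : ℤ_[2]) : ℚ_[2] := (cstB n)⁻¹ * DB n t

/-- `Fz n j = Fq n j` at every natural `j`. [cite: Lai2025TwoAdicZeta, Lemma 6.3 (proof)] -/
theorem Fz_natCast (n j : ℕ) : Fz n (j : ℤ_[2]) = Fq n j := by
  rw [Fz, DB_natCast_eq, ← mul_assoc, inv_mul_cancel₀ (cstB_ne_zero n), one_mul]

/-- The Riemann sums of `Fz n` tend to `(cstB n)⁻¹·T_n`. [cite: Lai2025TwoAdicZeta, Definition 3.2 / Lemma 6.3 (proof)] -/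
theorem tendsto_volkenbornSum_Fz (n : ℕ) : Tendsto (volkenbornSum 2 (Fz n)) atTop (𝓝 ((cstB n)⁻¹ * T n)) := by
  refine ((tendsto_volkenbornSum_DB_T n).const_mul (cstB n)⁻¹).congr fun N => ?_
  rw [← smul_eq_mul, ← volkenbornSum_smul]
  rfl

/-- The Riemann sum of `Fz n` at level `m` is `2^{−m}Σ_{k<2^m} Fq n k`, of norm `2^m` when `n = 2^m − 1`.
[cite: Lai2025TwoAdicZeta, Lemma 6.3 (proof of (eqn_5_1): the sum 2^{−m}Σ_{k<2^m} g(k)binom(k+2^m−1,2^m−1)²⋯)] -/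
theorem norm_volkenbornSum_Fz_mersenne {m : ℕ} (hm : 1 ≤ m) :
    ‖volkenbornSum 2 (Fz (2 ^ m - 1)) m‖ = (2 : ℝ) ^ m := by
  rw [volkenbornSum_def, norm_smul, norm_inv, norm_pow, Padic.norm_p, inv_pow, inv_inv]
  have e : ∑ k ∈ range (2 ^ m), Fz (2 ^ m - 1) (k : ℤ_[2]) = ∑ k ∈ range (2 ^ m), Fq (2 ^ m - 1) k :=
    sum_congr rfl fun k _ => Fz_natCast _ k
  push_cast
  rw [e, norm_sum_Fq_eq_one hm, mul_one]

/-- **Lemma 6.3 at `s = 0` (exact valuation):** for `n = 2^m − 1`, `m ≥ 1`,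
`‖T_n‖₂ = 2^{−(10n+4)} · ‖n!‖₂² · 2^m`, i.e. `v₂(T_n) = 10n + 4 + 2v₂(n!) − m` (`= 12n − 3m + 4` as `v₂(n!) = n − m`;
with `v₂(d_n) = m − 1` this is the printed `v₂(d_n³T_n) = 12n + 1`).  Proof as printed: `Δ_m(F) ≥ −m + 2` gives
`∫F ≡ 2^{−m}Σ_{k<2^m}F(k) (mod 2^{−m+1}ℤ₂)` and the sum is a `2`-adic unit. [cite: Lai2025TwoAdicZeta, Lemma 6.3] -/
theorem norm_T_mersenne {m : ℕ} (hm : 1 ≤ m) :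
    ‖T (2 ^ m - 1)‖ = ‖cstB (2 ^ m - 1)‖ * (2 : ℝ) ^ m := by
  set n : ℕ := 2 ^ m - 1 with hn
  have h2m : 1 ≤ 2 ^ m := Nat.one_le_two_pow
  have hnm : n < 2 ^ m := by omega
  -- `Δ_m(F) ≥ −m + 2`: the Lipschitz constant along `2^m ℕ` is `≤ 2^{m−2}`
  have hlog : Nat.log 2 n = m - 1 := by
    rcases Nat.eq_zero_or_pos n with h0 | hn0
    · have : m = 1 := by
        by_contra h; have : 2 ≤ m := by omega
        have : 4 ≤ 2 ^ m := by calc (4 : ℕ) = 2 ^ 2 := by norm_num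
          _ ≤ 2 ^ m := Nat.pow_le_pow_right (by norm_num) this
        omega
      subst this; simp [h0]
    · refine le_antisymm ?_ ?_
      · have := (Nat.log_lt_iff_lt_pow (by norm_num) hn0.ne').2 hnm; omega
      · refine Nat.le_log_of_pow_le (by norm_num) ?_
        have : 2 ^ m = 2 * 2 ^ (m - 1) := by rw [← pow_succ']; congr 1; omega
        omega
  have hLip := lipNatMod_Fq hm hnm
  set M : ℝ := max ((2 : ℝ) ^ Nat.log 2 n / 2) ‖(4 : ℚ_[2])‖ with hM
  have hM0 : 0 ≤ M := le_max_of_le_left (by positivity)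
  have hMle : 2 * M ≤ (2 : ℝ) ^ (m - 1 : ℕ) := by
    rw [hM, hlog, norm_four]
    rcases Nat.eq_zero_or_pos (m - 1) with h0 | h1
    · rw [h0]; norm_num
    · have h4 : (4 : ℝ)⁻¹ ≤ 2 ^ (m - 1) / 2 := by
        have : (2 : ℝ) ≤ 2 ^ (m - 1) := by
          calc (2 : ℝ) = 2 ^ 1 := by norm_num
            _ ≤ 2 ^ (m - 1) := pow_le_pow_right₀ (by norm_num) h1
        linarith
      rw [max_eq_left h4]; ring_nf; rfl
  -- the Lipschitz clause transported to `Fz`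
  have hLip' : LipNatMod 2 m M (fun k : ℕ => Fz n (k : ℤ_[2])) := by
    intro k h
    show ‖Fz n ((k + 2 ^ m * h : ℕ) : ℤ_[2]) - Fz n ((k : ℕ) : ℤ_[2])‖ ≤ M * ‖((2 ^ m * h : ℕ) : ℚ_[2])‖
    rw [Fz_natCast, Fz_natCast]
    exact hLip k h
  -- digit peeling: `‖I − S_m‖ ≤ 2M ≤ 2^{m−1}`
  have hI := tendsto_volkenbornSum_Fz n
  have hclose := norm_sub_volkenbornSum_le_of_lipNatMod (p := 2) hM0 hLip' hI
  have hSm : ‖volkenbornSum 2 (Fz n) m‖ = (2 : ℝ) ^ m := norm_volkenbornSum_Fz_mersenne hm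
  have hlt : ‖(cstB n)⁻¹ * T n - volkenbornSum 2 (Fz n) m‖ < ‖volkenbornSum 2 (Fz n) m‖ := by
    rw [hSm]
    have h1 : ‖(cstB n)⁻¹ * T n - volkenbornSum 2 (Fz n) m‖ ≤ (2 : ℝ) ^ (m - 1 : ℕ) :=
      hclose.trans (by push_cast; linarith)
    exact h1.trans_lt (pow_lt_pow_right₀ (by norm_num) (by omega))
  have hkey : ‖(cstB n)⁻¹ * T n‖ = (2 : ℝ) ^ m := by
    have e : (cstB n)⁻¹ * T n = ((cstB n)⁻¹ * T n - volkenbornSum 2 (Fz n) m) + volkenbornSum 2 (Fz n) m := by ring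
    rw [e, Padic.add_eq_max_of_ne (ne_of_lt hlt), max_eq_right hlt.le, hSm]
  rw [norm_mul, norm_inv] at hkey
  have hc : ‖cstB n‖ ≠ 0 := norm_ne_zero_iff.2 (cstB_ne_zero n)
  field_simp at hkey
  linarith [hkey]

/-- **Lemma 6.3 at `s = 0` ("In particular `T_n ≠ 0`")** along `n = 2^m − 1`, `m ≥ 1`. [cite: Lai2025TwoAdicZeta, Lemma 6.3 ("In particular, d_n^{2s+3}T_n ≠ 0")] -/
theorem T_mersenne_ne_zero {m : ℕ} (hm : 1 ≤ m) : T (2 ^ m - 1) ≠ 0 := by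
  intro h
  have h1 := norm_T_mersenne hm
  rw [h, norm_zero] at h1
  have h2 : 0 < ‖cstB (2 ^ m - 1)‖ * (2 : ℝ) ^ m := mul_pos (norm_pos_iff.2 (cstB_ne_zero _)) (by positivity)
  linarith

/-- `‖2^{10n+4}(n!)²‖₂ = 2^{−(10n+4)}·‖n!‖₂²`. [cite: Lai2025TwoAdicZeta, Lemma 6.3 (proof: v₂ of the prefactor 2^{(5s+10)n+2s+4} n!^{s+2})] -/
theorem norm_cstB (n : ℕ) : ‖cstB n‖ = (2 : ℝ) ^ (-((10 * n + 4 : ℕ) : ℤ)) * ‖((n ! : ℕ) : ℚ_[2])‖ ^ 2 := by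
  rw [cstB, norm_mul, norm_two_pow, norm_pow]

/-- `⌊log₂(2^m − 1)⌋ + 1 = m` (`m ≥ 1`). [folklore] -/
private theorem log_two_mersenne_add_one {m : ℕ} (hm : 1 ≤ m) : Nat.log 2 (2 ^ m - 1) + 1 = m := by
  have h2m : 1 ≤ 2 ^ m := Nat.one_le_two_pow
  rcases Nat.eq_zero_or_pos (2 ^ m - 1) with h0 | hn0
  · have hm1 : m = 1 := by
      by_contra h
      have h4 : 2 ^ 2 ≤ 2 ^ m := Nat.pow_le_pow_right (by norm_num) (by omega)
      omega
    subst hm1; simp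
  · refine le_antisymm ?_ ?_
    · have := (Nat.log_lt_iff_lt_pow (by norm_num) hn0.ne').2 (show 2 ^ m - 1 < 2 ^ m by omega); omega
    · have h := Nat.le_log_of_pow_le (b := 2) (by norm_num) (show 2 ^ (m - 1) ≤ 2 ^ m - 1 by
        have : 2 ^ m = 2 * 2 ^ (m - 1) := by rw [← pow_succ']; congr 1; omega
        omega)
      omega

/-- **The `2`-adic smallness of the linear forms** along `n = 2^m − 1` (`m ≥ 1`): `‖T_n‖₂ ≤ 2^{3m − 12n − 4}`
(`v₂(T_n) = 12n − 3m + 4` with Legendre's `v₂(n!) ≥ n − ⌊log₂ n⌋ − 1 = n − m`; printed: `|d_n^{2s+3}T_n|₂ = 2^{−(6s+12+o(1))n}`).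
[cite: Lai2025TwoAdicZeta, Lemma 6.3 ("|d_n^{2s+3}T_n|_2 = 2^{(−6s−12+o(1))n}")] -/
theorem norm_T_mersenne_le {m : ℕ} (hm : 1 ≤ m) :
    ‖T (2 ^ m - 1)‖ ≤ (2 : ℝ) ^ (3 * (m : ℤ) - 12 * ((2 ^ m - 1 : ℕ) : ℤ) - 4) := by
  set n : ℕ := 2 ^ m - 1 with hn
  have hf : ‖((n ! : ℕ) : ℚ_[2])‖ ≤ (2 : ℝ) ^ ((m : ℤ) - n) := by
    have h := norm_factorial_le n
    rwa [log_two_mersenne_add_one hm] at h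
  rw [norm_T_mersenne hm, norm_cstB]
  have h0 : 0 ≤ ‖((n ! : ℕ) : ℚ_[2])‖ := norm_nonneg _
  calc (2 : ℝ) ^ (-((10 * n + 4 : ℕ) : ℤ)) * ‖((n ! : ℕ) : ℚ_[2])‖ ^ 2 * 2 ^ m
      ≤ (2 : ℝ) ^ (-((10 * n + 4 : ℕ) : ℤ)) * ((2 : ℝ) ^ ((m : ℤ) - n)) ^ 2 * 2 ^ m := by
        gcongr
    _ = (2 : ℝ) ^ (3 * (m : ℤ) - 12 * (n : ℤ) - 4) := by
        rw [sq, ← zpow_natCast (2 : ℝ) m, ← zpow_add₀ two_ne_zero, ← zpow_add₀ two_ne_zero, ← zpow_add₀ two_ne_zero]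
        congr 1
        push_cast
        ring

end Literature.NumberTheory.Irrationality.Lai2025TwoAdic
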